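import Summits.QuantumFields.YangMills.Theses.UnitScaleTilt
import Summits.QuantumFields.YangMills.Theorems.UnitScaleTiltFluctuationComparisonRegPrPrintChiLine
import Summits.QuantumFields.YangMills.Theorems.UnitScaleTiltFluctuationComparisonRegPrPrintChiTransfer
import Summits.QuantumFields.YangMills.Theorems.UnitScaleTiltFluctuationComparisonRegPrOneStepSubmersion
import Summits.QuantumFields.YangMills.Theorems.UnitScaleTiltFluctuationComparisonRegPrAnsatzTStub
import Literature.MathematicalPhysics.QuantumFieldTheory.Balaban1983to89.T3PrintedMinimiserExistence
import HarnessLib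

/-!
# Crux-ideate sketch g13 (ideator 2, lens NEGATION → repaired statement) — «edge band to the tail»
# (`Cruxes/FluctuationComparisonRegPr/Ideas/edge-band-to-the-tail.md`)

Seat `ym-cruxidea-19201-2` (planner; crux-ideate ideator 2∕2 on stmt-QuantumFields-19201 `FluctuationComparisonRegPr`, aside;
live twin stmt-QuantumFields-19935 `FluctuationComparisonRegPrL`, skeleton v5j‴, rank-last STUB 4′ `stub_logComparisonSmallBlocks`,
odd `L ∈ {3,5}`), gen 13, 2026-08-27.  EVIDENCE ∕ SKETCH FILE, `sorry`-free.  Honest framing: nothing here asserts the two-run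
comparison, Bałaban's representation or [Balaban1985Variational] Thm 1; every Bałaban-side object is a HYPOTHESIS SCHEMA (the
tree's `BgStabilityAt`, `HistoryTailAt`, `Thm1GlobalMinAt`, `PrintChi.TwoSidedRepOn`, `PrintChi.PintCauchyOn`) and every theorem below
is measure theory ∕ bookkeeping over them.

THE LEVER.  The rung leaf consumes the two-run comparison ONLY through `T3UnitScaleTilt.UnitTiltTail r w w'`, whose events
`Gd₀ K, Gd₁ K` are ARBITRARY measurable sets, and King's four-measure lemma charges an excised event only its MASS.  So the
comparison need only hold a.e. on a DEEP INTERIOR `{V : PlaqSmall (θBal(c·b₀) ⌊K/m⌋) V}` of the window (`0 < c ≤ 1`, one constant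
per block size), provided the edge band `{¬PlaqSmall(θBal(c·b₀))} ∩ histGood(θBal b₀)` is sent to the TAIL — and its Gibbs mass is
bounded by `HistoryTailAt F γ (c·b₀) p₀ m`, i.e. by crux #3 `HistoryTailL` (stmt-19936) at a rescaled profile, which #3's own
quantifier «∀ (b₁,p₁) ∃ (b₀,p₀) ⪰ (b₁,p₁)» already serves.  On the deep interior both runs' data are χ-GOOD WITH MARGIN
(`PrintChi.ChiGood`, ★ym-ust-19935-r1 g0) as soon as `B₃·c ≤ 1` ([Balaban1985Variational] Thm 1 (8): the minimiser's finest plaquettes are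
`≤ B₃·(datum size)·η²`; then `PrintChi.exists_coupling_chiGood_of_printChi`), so the owner-sanctioned INNER stub (i)* alone feeds the
interior comparison and the located-unprinted EDGE-OSCILLATION stub (ii)* is not needed at any block size.

§0  Profile algebra: `θBal_mul` (`θBal(c·b₀) = c·θBal(b₀)`, `B10.pFun` is linear in `b₀`), `θBal_mul_le`, `histGood_mono_profile`.
§1  THE RE-TYPED CRUX: `BgFluctuationIntAt … c` (= `T3RegularMinimiser.BgFluctuationAt` with its a.e. clause asserted on the
    `c`-interior only; the DENSITIES are unchanged — still restricted to `histGood(θBal b₀ p₀)`), `FluctuationComparisonRegPrIntAt`,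
    `FluctuationComparisonRegPrIntL` (`∃ c b₁ p₁` right after `L`); `…IntAt_of_At`, `regPrIntL_of_regPrL`: the new statement is
    FORMALLY WEAKER than 19935 (`c = 1`).
§2  The interior events `histGoodInt` and the one measure-theoretic fact the re-glue needs: `resDensity_inter_preimage_ae`
    (`ρ^{S ∩ (Ū^k)⁻¹E}_k = 1_E · ρ^S_k` a.e., Radon–Nikodym uniqueness from `integral_resDensity_mul`) and its reading at the comparison
    height `heightDensity_histGoodInt_ae`.
§3  Interior stability + interior comparison ⇒ the a.e. two-run SANDWICH of the interior-restricted densities EVERYWHERE (off the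
    interior both vanish) ⇒ `IsTilt` of the unit push-forwards with the interior events (`T3TiltDescent` by name).
§4  K2 for the interior events from the tail at the shrunken profile: `histGood(θBal(c·b₀)) ⊆ histGoodInt`.
§5  One family: `unitTiltTail_of_interior`.
§6  THE RE-GLUED DECIDING THEOREM `closesInt : MinimiserStabilityRegPr → FluctuationComparisonRegPrIntL → HistoryTailL → YM3TorusSU2`
    (kernel-checked; `b₀ := b₀'/c` where `(b₀', p₀)` is #3's profile above 19935ᴵ's thresholds).
§7  WHY EASIER: `bgFluctuationIntAt_of_socketOn` — the interior comparison for one family from ★r1's `S`-restricted socket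
    (`TwoSidedRepOn S` ∧ `PintCauchyOn S`, [Balaban1985UV3] (41)∧(47) on `χ_k` + King's Cauchy property) for ANY predicate `S` that the
    interior implies for both runs, plus interior positivity — NO edge clause; and `interior_chiGood_of_thm1GlobalMinAt` — (E1): the
    `c`-interior is doubly χ-good with print's margin `μ_L = 1 − 2/(L√L)` whenever `B₃c ≤ 1`, from the tree's schema `Thm1GlobalMinAt`
    (block-size level: the coupling threshold hoists above `∀ F`).
§8  `regPrIntL_of_innerChi'` — THE PROPOSED ITEM TEXT 19935ᴵ from ★r1's sanctioned inner body (i)* for EVERY odd block size (no `L < 7`)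
    and `Thm1GlobalMin L` (displayed schema of the line of record) ALONE — window positivity discharged by name (`posOnSmall_of_oneStepSmallLift`
    ∘ the landed STUB 1); `c := (B₃ ∨ 1)⁻¹`, `m₀ ≥ 2`.  No clause (ii)*, no `K = 0` corner.

References: T. Bałaban, CMP 102 (1985) 255–275 [Balaban1985UV3] ((7) p.257, (41) p.266, (47) p.267, (71) p.273); CMP 102 (1985)
277–309 [Balaban1985Variational] (Thm 1 (8) p.279); CMP 98 (1985) 17–51 [Balaban1985Averaging] (Prop. 2 (53) p.26); C. King, CMP 102
(1986) 649–677 [King1986] (Thm 3.4 (3.9)–(3.13) p.656, (3.12) p.657).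
-/

noncomputable section

open MeasureTheory Filter Topology Set
open Literature.MathematicalPhysics.QuantumFieldTheory.Balaban1983to89
open Literature.MathematicalPhysics.QuantumFieldTheory.Balaban1983to89.T3ContinuumYM3Torus
open Literature.MathematicalPhysics.QuantumFieldTheory.Balaban1983to89.T3LevelShift
open Literature.MathematicalPhysics.QuantumFieldTheory.Balaban1983to89.T3UnitLawDensityEML (ℰp measurableE_ℰp)
open Literature.MathematicalPhysics.QuantumFieldTheory.Balaban1983to89.T3UnitScaleTilt
open Literature.MathematicalPhysics.QuantumFieldTheory.Balaban1983to89.T3RestrictedUnitDensity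
open Literature.MathematicalPhysics.QuantumFieldTheory.Balaban1983to89.T3TiltDescent
open Literature.MathematicalPhysics.QuantumFieldTheory.Balaban1983to89.T3CruxEstimates
open Literature.MathematicalPhysics.QuantumFieldTheory.Balaban1983to89.T3RegularMinimiser
open Literature.MathematicalPhysics.QuantumFieldTheory.Balaban1983to89.T3PrintedRegularMinimiser
open Literature.MathematicalPhysics.QuantumFieldTheory.Balaban1983to89.T3PrintedMinimiserExistence
open Literature.MathematicalPhysics.QuantumFieldTheory.Balaban1983to89.T3MinimiserStabilityReduction (θBal_pos)
open Literature.MathematicalPhysics.QuantumFieldTheory.Balaban1983to89.T3ThresholdSmallness (exists_forall_θBal_le)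
open Literature.MathematicalPhysics.QuantumFieldTheory.Balaban1983to89.Missing

namespace Summit.QuantumFields.YangMills.Cruxes.FluctuationComparisonRegPr.Ideate2Excision

/-! ## §0 Profile algebra -/

/-- `θBal` is linear in `b₀` (`p(g) = b₀(1 + log g⁻¹)^{p₀}`). [cite: Balaban1985UV3, (7) p.257] -/
theorem θBal_mul (L : ℕ) (γ c b₀ p₀ : ℝ) (i : ℕ) : θBal L γ (c * b₀) p₀ i = c * θBal L γ b₀ p₀ i := by
  simp only [θBal, B10.pFun]
  ring

/-- A shrunken profile lies below the sharp one (`0 < γ ≤ 1`, `0 < b₀`, `0 ≤ c ≤ 1`). [cite: Balaban1985UV3, (7) p.257] -/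
theorem θBal_mul_le {L : ℕ} (hL : 1 ≤ L) {γ b₀ c : ℝ} (hγ : 0 < γ) (hγ1 : γ ≤ 1) (hb : 0 < b₀) (hc1 : c ≤ 1) (p₀ : ℝ) (i : ℕ) :
    θBal L γ (c * b₀) p₀ i ≤ θBal L γ b₀ p₀ i := by
  rw [θBal_mul]
  exact mul_le_of_le_one_left (θBal_pos hL hγ hγ1 hb p₀ i).le hc1

/-- The history events are monotone in the profile. [cite: Balaban1985UV3, (7) p.257] -/
theorem histGood_mono_profile (F : T3Family) {θ θ' : ℕ → ℝ} (h : ∀ i, θ i ≤ θ' i) (K n : ℕ) :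
    histGood F ℰp θ K n ⊆ histGood F ℰp θ' K n := by
  intro U hU j hj p
  exact (hU j hj p).trans_le (h _)

/-! ## §1 The re-typed crux: the comparison asserted on the deep interior only -/

section Interior

variable (F : T3Family) (γ b₀ p₀ : ℝ) (m : ℕ)
  (A₀ A₁ : (K : ℕ) → GaugeField (F.P (K / m)) 0 (Matrix.specialUnitaryGroup (Fin 2) ℂ) → ℝ) (c : ℝ)

/-- **FLUCTUATION COMPARISON ON THE DEEP INTERIOR, AWAY FROM THE COARSEST STEP** (hypothesis schema, never asserted):
`T3RegularMinimiser.BgFluctuationAt` with its a.e. clause asserted only for steps `K ≥ 1` and only at data `V` in the `c`-interior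
`PlaqSmall (θBal(c·b₀) ⌊K/m⌋) V` of the window; the two restricted densities are the SAME as in the route (events `histGood(θBal b₀ p₀)`, nothing
re-windowed).  Both excisions are paid for in the glue: the edge band by the tail at profile `c·b₀`, the step `K = 0` by an empty good event
(`IsTilt.zero_right`, mass `1` once). [cite: King1986, Prop. 3.8-3.9 pp.664-665] -/
def BgFluctuationIntAt : Prop :=
  ∃ (r κ : ℕ → ℝ), Summable r ∧ (∀ K, 0 ≤ r K) ∧
    ∀ K, 0 < K → ∀ᵐ V ∂fieldMeasure (F.P (K / m)) 0 (Matrix.specialUnitaryGroup (Fin 2) ℂ),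
      PlaqSmall (θBal F.L γ (c * b₀) p₀ (K / m)) V →
        0 < heightDensity F γ (Nat.div_le_self K m) (histGood F ℰp (θBal F.L γ b₀ p₀) K (K / m)) V ∧
        0 < heightDensity F γ ((Nat.div_le_self K m).trans (Nat.le_succ K)) (histGood F ℰp (θBal F.L γ b₀ p₀) (K + 1) (K / m)) V ∧
        |(Real.log (heightDensity F γ ((Nat.div_le_self K m).trans (Nat.le_succ K))
              (histGood F ℰp (θBal F.L γ b₀ p₀) (K + 1) (K / m)) V) + A₁ K V) -
          (Real.log (heightDensity F γ (Nat.div_le_self K m) (histGood F ℰp (θBal F.L γ b₀ p₀) K (K / m)) V) + A₀ K V) -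
            κ K| ≤ r K

variable (ε₀ : ℝ)

/-- The same at print's regular backgrounds `bgRegPr`, `bgRegPr'` (the route's twin `FluctuationComparisonRegPrAt`, interior version).
[cite: Balaban1985UV3, (41) p.266] -/
def FluctuationComparisonRegPrIntAt : Prop :=
  BgFluctuationIntAt F γ b₀ p₀ m (bgRegPr F γ m ε₀) (bgRegPr' F γ m ε₀) c

end Interior

/-- **19935ᴵ — THE PROPOSED ITEM TEXT** (quantifier prefix of `FluctuationComparisonRegPrL` verbatim, with ONE interior constant `c ∈ (0,1]` per
block size chosen together with the thresholds): for every `L` there are `c, b₁, p₁` such that for every profile above the thresholds … the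
interior comparison `FluctuationComparisonRegPrIntAt F γ b₀ p₀ m ε₀ c`. [cite: King1986, Prop. 3.8-3.9 pp.664-665] -/
def FluctuationComparisonRegPrIntL : Prop :=
  ∀ (L : ℕ), ∃ (c b₁ p₁ : ℝ), 0 < c ∧ c ≤ 1 ∧ ∀ (b₀ p₀ : ℝ), b₁ ≤ b₀ → p₁ ≤ p₀ → 0 < b₀ → 2 < p₀ →
    ∃ ε₁ : ℝ, 0 < ε₁ ∧ ∀ (ε₀ : ℝ), 0 < ε₀ → ε₀ ≤ ε₁ → ∃ m₀ : ℕ, ∀ (m : ℕ), m₀ ≤ m →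
      ∃ γ₁ : ℝ, 0 < γ₁ ∧ ∀ (F : T3Family) (γ : ℝ), F.L = L → 0 < γ → γ ≤ γ₁ →
        FluctuationComparisonRegPrIntAt F γ b₀ p₀ m c ε₀

/-- The full-window comparison is the case `c = 1`. [cite: King1986, Prop. 3.8-3.9 pp.664-665] -/
theorem bgFluctuationIntAt_of_at {F : T3Family} {γ b₀ p₀ : ℝ} {m : ℕ}
    {A₀ A₁ : (K : ℕ) → GaugeField (F.P (K / m)) 0 (Matrix.specialUnitaryGroup (Fin 2) ℂ) → ℝ}
    (h : BgFluctuationAt F γ b₀ p₀ m A₀ A₁) : BgFluctuationIntAt F γ b₀ p₀ m A₀ A₁ 1 := by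
  obtain ⟨r, κ, hr, hr0, hae⟩ := h
  refine ⟨r, κ, hr, hr0, fun K _ => ?_⟩
  filter_upwards [hae K] with V hV hs
  rw [one_mul] at hs
  exact hV hs

/-- **19935 ⇒ 19935ᴵ**: the proposed text is FORMALLY WEAKER than the item of record. [cite: King1986, Prop. 3.8-3.9 pp.664-665] -/
theorem regPrIntL_of_regPrL (h : Theses.UnitScaleTilt.FluctuationComparisonRegPrL) : FluctuationComparisonRegPrIntL := by
  intro L
  obtain ⟨b₁, p₁, hB⟩ := h L
  refine ⟨1, b₁, p₁, one_pos, le_rfl, fun b₀ p₀ hb₁ hp₁ hb hp => ?_⟩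
  obtain ⟨ε₁, hε₁, hB'⟩ := hB b₀ p₀ hb₁ hp₁ hb hp
  refine ⟨ε₁, hε₁, fun ε₀ hε hεle => ?_⟩
  obtain ⟨m₀, hm⟩ := hB' ε₀ hε hεle
  refine ⟨m₀, fun m hmle => ?_⟩
  obtain ⟨γ₁, hγ₁, hB''⟩ := hm m hmle
  exact ⟨γ₁, hγ₁, fun F γ hL hγ hle => bgFluctuationIntAt_of_at (hB'' F γ hL hγ hle)⟩

/-! ## §2 The interior events and the density identity -/

section Events

variable (F : T3Family)

/-- **THE INTERIOR EVENT**: Bałaban's UV-small history with profile `θ` AND the top remembered height (`K − n` averagings, the comparison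
lattice) inside the smaller window `θI`. [cite: Balaban1985UV3, (7) p.257] -/
def histGoodInt (θ : ℕ → ℝ) (θI : ℝ) (K n : ℕ) : Set (GaugeField (F.P K) 0 (Matrix.specialUnitaryGroup (Fin 2) ℂ)) :=
  histGood F ℰp θ K n ∩
    {U | PlaqSmall θI (Averaging.iter (fun i => BlockAveraging.blockAvg (P := F.P K) (j := i) ℰp) (K - n) U)}

theorem measurableSet_histGoodInt (θ : ℕ → ℝ) (θI : ℝ) (K n : ℕ) : MeasurableSet (histGoodInt F θ θI K n) :=
  (measurableSet_histGood F ℰp measurableE_ℰp θ K n).inter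
    (T4Continuum.measurable_iter _ (F.avgMeasurable_of_measurableE ℰp measurableE_ℰp K) (K - n) (measurableSet_plaqSmall θI))

/-- A history with a profile below `θ` whose level-`n` threshold is below `θI` lies in the interior event. [cite: Balaban1985UV3, (7) p.257] -/
theorem histGood_subset_histGoodInt {θ θ' : ℕ → ℝ} (h : ∀ i, θ' i ≤ θ i) {θI : ℝ} {K n : ℕ} (hn : n ≤ K) (hI : θ' n ≤ θI) :
    histGood F ℰp θ' K n ⊆ histGoodInt F θ θI K n := by
  intro U hU
  refine ⟨histGood_mono_profile F h K n hU, fun p => ?_⟩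
  have htop := hU (K - n) (by omega)
  rw [show K - (K - n) = n by omega] at htop
  exact (htop p).trans_le hI

/-- **RESTRICTING BY AN EVENT OF THE AVERAGED FIELD MULTIPLIES THE RESTRICTED DENSITY BY ITS INDICATOR**: `ρ^{S ∩ (Ū^k)⁻¹E}_k = 1_E·ρ^S_k`
almost everywhere (both sides satisfy the push-forward identity `integral_resDensity_mul` against every bounded measurable test function;
Radon–Nikodym uniqueness `Integrable.ae_eq_of_forall_setIntegral_eq`). [cite: Balaban1985UV3, (2) p.256 and (7) p.257] -/
theorem resDensity_inter_preimage_ae {γ : ℝ} (hγ : 0 ≤ γ) (K : ℕ)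
    {S : Set (GaugeField (F.P K) 0 (Matrix.specialUnitaryGroup (Fin 2) ℂ))} (hS : MeasurableSet S) {k : ℕ} (hk : k ≤ F.m + K)
    {E : Set (GaugeField (F.P K) k (Matrix.specialUnitaryGroup (Fin 2) ℂ))} (hE : MeasurableSet E) :
    resDensity F γ K (S ∩ {U | Averaging.iter (fun i => BlockAveraging.blockAvg (P := F.P K) (j := i) ℰp) k U ∈ E}) k
      =ᵐ[fieldMeasure (F.P K) k (Matrix.specialUnitaryGroup (Fin 2) ℂ)] E.indicator (resDensity F γ K S k) := by
  have hiter : Measurable (Averaging.iter (fun i => BlockAveraging.blockAvg (P := F.P K) (j := i) ℰp) k) :=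
    T4Continuum.measurable_iter _ (F.avgMeasurable_of_measurableE ℰp measurableE_ℰp K) k
  have hT : MeasurableSet (S ∩ {U | Averaging.iter (fun i => BlockAveraging.blockAvg (P := F.P K) (j := i) ℰp) k U ∈ E}) :=
    hS.inter (hiter hE)
  have hbdd : ∀ T : Set (GaugeField (F.P K) k (Matrix.specialUnitaryGroup (Fin 2) ℂ)),
      ∃ C : ℝ, ∀ V, |T.indicator (fun _ => (1 : ℝ)) V| ≤ C :=
    fun T => ⟨1, fun V => by by_cases hV : V ∈ T <;> simp [hV]⟩
  refine Integrable.ae_eq_of_forall_setIntegral_eq _ _ (integrable_resDensity F K hT hγ hk)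
    ((integrable_resDensity F K hS hγ hk).indicator hE) fun B hB _ => ?_
  have e1 : ∫ V in B, resDensity F γ K (S ∩ {U | Averaging.iter (fun i => BlockAveraging.blockAvg (P := F.P K) (j := i) ℰp) k U ∈ E}) k V
        ∂fieldMeasure (F.P K) k (Matrix.specialUnitaryGroup (Fin 2) ℂ) =
      ∫ V, resDensity F γ K (S ∩ {U | Averaging.iter (fun i => BlockAveraging.blockAvg (P := F.P K) (j := i) ℰp) k U ∈ E}) k V *
        B.indicator (fun _ => (1 : ℝ)) V ∂fieldMeasure (F.P K) k (Matrix.specialUnitaryGroup (Fin 2) ℂ) := by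
    rw [← integral_indicator hB]
    refine integral_congr_ae (Eventually.of_forall fun V => ?_)
    by_cases hV : V ∈ B <;> simp [hV]
  have e2 : ∫ V in B, E.indicator (resDensity F γ K S k) V ∂fieldMeasure (F.P K) k (Matrix.specialUnitaryGroup (Fin 2) ℂ) =
      ∫ V, resDensity F γ K S k V * (E ∩ B).indicator (fun _ => (1 : ℝ)) V
        ∂fieldMeasure (F.P K) k (Matrix.specialUnitaryGroup (Fin 2) ℂ) := by
    rw [← integral_indicator hB]
    refine integral_congr_ae (Eventually.of_forall fun V => ?_)
    by_cases hV : V ∈ B <;> by_cases hV' : V ∈ E <;> simp [hV, hV']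
  rw [e1, e2, integral_resDensity_mul F K hT hγ hk _ (measurable_const.indicator hB) (hbdd B),
    integral_resDensity_mul F K hS hγ hk _ (measurable_const.indicator (hE.inter hB)) (hbdd _)]
  refine integral_congr_ae (Eventually.of_forall fun U => ?_)
  by_cases hU : U ∈ S <;>
    by_cases hUE : Averaging.iter (fun i => BlockAveraging.blockAvg (P := F.P K) (j := i) ℰp) k U ∈ E <;>
      by_cases hUB : Averaging.iter (fun i => BlockAveraging.blockAvg (P := F.P K) (j := i) ℰp) k U ∈ B <;>
        simp [hU, hUE, hUB]

/-- **AT THE COMPARISON HEIGHT**: the interior-restricted density is the indicator of the interior times the route's density, almost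
everywhere on the comparison lattice. [cite: Balaban1985UV3, (7) p.257 and (41) p.266] -/
theorem heightDensity_histGoodInt_ae {γ : ℝ} (hγ : 0 ≤ γ) {n K : ℕ} (hK : n ≤ K) (θ : ℕ → ℝ) (θI : ℝ) :
    ∀ᵐ V ∂fieldMeasure (F.P n) 0 (Matrix.specialUnitaryGroup (Fin 2) ℂ),
      heightDensity F γ hK (histGoodInt F θ θI K n) V =
        {W : GaugeField (F.P n) 0 (Matrix.specialUnitaryGroup (Fin 2) ℂ) | PlaqSmall θI W}.indicator
          (heightDensity F γ hK (histGood F ℰp θ K n)) V := by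
  have hE : MeasurableSet {W : GaugeField (F.P K) (K - n) (Matrix.specialUnitaryGroup (Fin 2) ℂ) | PlaqSmall θI W} :=
    measurableSet_plaqSmall θI
  have hae := resDensity_inter_preimage_ae F hγ K (measurableSet_histGood F ℰp measurableE_ℰp θ K n) (k := K - n) (by omega) hE
  have hmp := measurePreserving_fieldShift (G := Matrix.specialUnitaryGroup (Fin 2) ℂ)
    (F.sitesPerDir_eq (m := F.m) (K := K) (j := K - n) (m' := F.m) (K' := n) (j' := 0) (by omega))
  filter_upwards [hmp.quasiMeasurePreserving.ae hae] with V hV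
  have hV' : resDensity F γ K (histGoodInt F θ θI K n) (K - n)
        (fieldShift (F.sitesPerDir_eq (m := F.m) (K := K) (j := K - n) (m' := F.m) (K' := n) (j' := 0) (by omega)) V) =
      {W : GaugeField (F.P K) (K - n) (Matrix.specialUnitaryGroup (Fin 2) ℂ) | PlaqSmall θI W}.indicator
        (resDensity F γ K (histGood F ℰp θ K n) (K - n))
        (fieldShift (F.sitesPerDir_eq (m := F.m) (K := K) (j := K - n) (m' := F.m) (K' := n) (j' := 0) (by omega)) V) := hV
  show resDensity F γ K (histGoodInt F θ θI K n) (K - n)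
      (fieldShift (F.sitesPerDir_eq (m := F.m) (K := K) (j := K - n) (m' := F.m) (K' := n) (j' := 0) (by omega)) V) = _
  by_cases hs : PlaqSmall θI V
  · have hs' : fieldShift (F.sitesPerDir_eq (m := F.m) (K := K) (j := K - n) (m' := F.m) (K' := n) (j' := 0) (by omega)) V ∈
        {W : GaugeField (F.P K) (K - n) (Matrix.specialUnitaryGroup (Fin 2) ℂ) | PlaqSmall θI W} :=
      (plaqSmall_fieldShift F _ θI V).mpr hs
    have hsV : V ∈ {W : GaugeField (F.P n) 0 (Matrix.specialUnitaryGroup (Fin 2) ℂ) | PlaqSmall θI W} := hs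
    calc resDensity F γ K (histGoodInt F θ θI K n) (K - n)
          (fieldShift (F.sitesPerDir_eq (m := F.m) (K := K) (j := K - n) (m' := F.m) (K' := n) (j' := 0) (by omega)) V)
        = resDensity F γ K (histGood F ℰp θ K n) (K - n)
          (fieldShift (F.sitesPerDir_eq (m := F.m) (K := K) (j := K - n) (m' := F.m) (K' := n) (j' := 0) (by omega)) V) := by
            rw [hV']; exact Set.indicator_of_mem hs' _
      _ = heightDensity F γ hK (histGood F ℰp θ K n) V := rfl
      _ = _ := (Set.indicator_of_mem hsV _).symm
  · have hs' : fieldShift (F.sitesPerDir_eq (m := F.m) (K := K) (j := K - n) (m' := F.m) (K' := n) (j' := 0) (by omega)) V ∉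
        {W : GaugeField (F.P K) (K - n) (Matrix.specialUnitaryGroup (Fin 2) ℂ) | PlaqSmall θI W} :=
      fun h => hs ((plaqSmall_fieldShift F _ θI V).mp h)
    have hsV : V ∉ {W : GaugeField (F.P n) 0 (Matrix.specialUnitaryGroup (Fin 2) ℂ) | PlaqSmall θI W} := hs
    calc resDensity F γ K (histGoodInt F θ θI K n) (K - n)
          (fieldShift (F.sitesPerDir_eq (m := F.m) (K := K) (j := K - n) (m' := F.m) (K' := n) (j' := 0) (by omega)) V)
        = 0 := by rw [hV']; exact Set.indicator_of_notMem hs' _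
      _ = _ := (Set.indicator_of_notMem hsV _).symm

end Events

/-! ## §3 Interior stability + interior comparison ⇒ the sandwich of the interior-restricted densities ⇒ the tilt -/

section Sandwich

variable {F : T3Family} {γ b₀ p₀ c : ℝ} {m : ℕ}
  {A₀ A₁ : (K : ℕ) → GaugeField (F.P (K / m)) 0 (Matrix.specialUnitaryGroup (Fin 2) ℂ) → ℝ}

/-- Pointwise: positive `H₀, H₁` with `|log H₁ − log H₀ − κ| ≤ r` satisfy `e^{−r}e^{κ}H₀ ≤ H₁ ≤ e^{r}e^{κ}H₀` (the tree's private helper of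
`T3RegularMinimiser`, re-proved). [cite: King1986, Thm 3.4 (3.9) p.656] -/
theorem sandwich_of_log {H₀ H₁ κ r : ℝ} (h₀ : 0 < H₀) (h₁ : 0 < H₁) (h : |Real.log H₁ - Real.log H₀ - κ| ≤ r) :
    Real.exp (-r) * Real.exp κ * H₀ ≤ H₁ ∧ H₁ ≤ Real.exp r * Real.exp κ * H₀ := by
  obtain ⟨hl, hu⟩ := abs_le.mp h
  have e : H₁ = Real.exp (Real.log H₁ - Real.log H₀) * H₀ := by
    rw [Real.exp_sub, Real.exp_log h₁, Real.exp_log h₀, div_mul_cancel₀ _ h₀.ne']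
  constructor
  · rw [e, ← Real.exp_add]
    exact mul_le_mul_of_nonneg_right (Real.exp_le_exp.mpr (by linarith)) h₀.le
  · rw [e, ← Real.exp_add]
    exact mul_le_mul_of_nonneg_right (Real.exp_le_exp.mpr (by linarith)) h₀.le

/-- **THE INTERIOR SANDWICH, EVERYWHERE**: background stability on the window and the comparison on the `c`-interior give, almost
everywhere on the comparison lattice, the two-run sandwich of the INTERIOR-restricted densities (radii `r + r'`, constants `e^{κ'−κ}`):
on the interior they are the route's densities (§2) and the log-sandwich applies; off it both vanish. [cite: King1986, Thm 3.4 (3.9) p.656] -/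
theorem interiorSandwich_of_bg (hγ : 0 ≤ γ) (hcθ : ∀ i, θBal F.L γ (c * b₀) p₀ i ≤ θBal F.L γ b₀ p₀ i)
    (hst : BgStabilityAt F γ b₀ p₀ m A₀ A₁) (hfl : BgFluctuationIntAt F γ b₀ p₀ m A₀ A₁ c) :
    ∃ (r C : ℕ → ℝ), Summable r ∧ (∀ K, 0 ≤ r K) ∧ (∀ K, 0 < C K) ∧
      ∀ K, 0 < K → ∀ᵐ V ∂fieldMeasure (F.P (K / m)) 0 (Matrix.specialUnitaryGroup (Fin 2) ℂ),
        Real.exp (-r K) * C K *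
            heightDensity F γ (Nat.div_le_self K m)
              (histGoodInt F (θBal F.L γ b₀ p₀) (θBal F.L γ (c * b₀) p₀ (K / m)) K (K / m)) V ≤
          heightDensity F γ ((Nat.div_le_self K m).trans (Nat.le_succ K))
              (histGoodInt F (θBal F.L γ b₀ p₀) (θBal F.L γ (c * b₀) p₀ (K / m)) (K + 1) (K / m)) V ∧
        heightDensity F γ ((Nat.div_le_self K m).trans (Nat.le_succ K))
              (histGoodInt F (θBal F.L γ b₀ p₀) (θBal F.L γ (c * b₀) p₀ (K / m)) (K + 1) (K / m)) V ≤
          Real.exp (r K) * C K *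
            heightDensity F γ (Nat.div_le_self K m)
              (histGoodInt F (θBal F.L γ b₀ p₀) (θBal F.L γ (c * b₀) p₀ (K / m)) K (K / m)) V := by
  obtain ⟨r, κ, hr, hr0, hm⟩ := hst
  obtain ⟨r', κ', hr', hr0', hf⟩ := hfl
  refine ⟨fun K => r K + r' K, fun K => Real.exp (κ' K - κ K), hr.add hr', fun K => add_nonneg (hr0 K) (hr0' K),
    fun K => Real.exp_pos _, fun K hK => ?_⟩
  have h0 := heightDensity_histGoodInt_ae F hγ (Nat.div_le_self K m) (θBal F.L γ b₀ p₀) (θBal F.L γ (c * b₀) p₀ (K / m))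
  have h1 := heightDensity_histGoodInt_ae F hγ ((Nat.div_le_self K m).trans (Nat.le_succ K)) (θBal F.L γ b₀ p₀)
    (θBal F.L γ (c * b₀) p₀ (K / m))
  filter_upwards [hf K hK, h0, h1] with V hV hV0 hV1
  rw [hV0, hV1]
  by_cases hs : PlaqSmall (θBal F.L γ (c * b₀) p₀ (K / m)) V
  · have hmem : V ∈ {W : GaugeField (F.P (K / m)) 0 (Matrix.specialUnitaryGroup (Fin 2) ℂ) |
        PlaqSmall (θBal F.L γ (c * b₀) p₀ (K / m)) W} := hs
    rw [Set.indicator_of_mem hmem, Set.indicator_of_mem hmem]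
    obtain ⟨hp₀, hp₁, hfl⟩ := hV hs
    have hsw : PlaqSmall (θBal F.L γ b₀ p₀ (K / m)) V := fun p => (hs p).trans_le (hcθ _)
    have hmn := hm K V hsw
    have hlog : |Real.log (heightDensity F γ ((Nat.div_le_self K m).trans (Nat.le_succ K))
          (histGood F ℰp (θBal F.L γ b₀ p₀) (K + 1) (K / m)) V) -
        Real.log (heightDensity F γ (Nat.div_le_self K m) (histGood F ℰp (θBal F.L γ b₀ p₀) K (K / m)) V) -
        (κ' K - κ K)| ≤ r K + r' K := by
      obtain ⟨a1, a2⟩ := abs_le.mp hfl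
      obtain ⟨b1, b2⟩ := abs_le.mp hmn
      exact abs_le.mpr ⟨by linarith, by linarith⟩
    exact sandwich_of_log hp₀ hp₁ hlog
  · have hmem : V ∉ {W : GaugeField (F.P (K / m)) 0 (Matrix.specialUnitaryGroup (Fin 2) ℂ) |
        PlaqSmall (θBal F.L γ (c * b₀) p₀ (K / m)) W} := hs
    rw [Set.indicator_of_notMem hmem, Set.indicator_of_notMem hmem]
    simp

/-- **THE UNIT-LATTICE TILT WITH THE INTERIOR EVENTS** (the `⌊K/m⌋` free averagings cost nothing: `T3TiltDescent` by name).
[cite: King1986, Thm 3.4 (3.9) p.656] -/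
theorem unitTilt_interior_of_bg (hγ : 0 ≤ γ) (hcθ : ∀ i, θBal F.L γ (c * b₀) p₀ i ≤ θBal F.L γ b₀ p₀ i)
    (hst : BgStabilityAt F γ b₀ p₀ m A₀ A₁) (hfl : BgFluctuationIntAt F γ b₀ p₀ m A₀ A₁ c) :
    ∃ r : ℕ → ℝ, Summable r ∧ (∀ K, 0 ≤ r K) ∧ ∀ K, 0 < K → IsTilt
      (Measure.map (unitA F ℰp K) ((gibbsK F ℰp γ K).restrict
        (histGoodInt F (θBal F.L γ b₀ p₀) (θBal F.L γ (c * b₀) p₀ (K / m)) K (K / m))))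
      (Measure.map (unitA F ℰp (K + 1)) ((gibbsK F ℰp γ (K + 1)).restrict
        (histGoodInt F (θBal F.L γ b₀ p₀) (θBal F.L γ (c * b₀) p₀ (K / m)) (K + 1) (K / m))))
      (r K) := by
  obtain ⟨r, C, hr, hr0, hC, hsand⟩ := interiorSandwich_of_bg hγ hcθ hst hfl
  exact ⟨r, hr, hr0, fun K hK => isTilt_unitA_of_isTilt_descendTo F ℰp measurableE_ℰp hγ (Nat.div_le_self K m) _ _
    (isTilt_descendTo_of_sandwich_ae F hγ (Nat.div_le_self K m) (measurableSet_histGoodInt F _ _ K _)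
      (measurableSet_histGoodInt F _ _ (K + 1) _) (hr0 K) (hC K) (hsand K hK))⟩

end Sandwich

/-! ## §4 K2 for the interior events: the edge band goes to the tail at the shrunken profile -/

section Tail

variable {F : T3Family} {γ b₀ p₀ c : ℝ} {m : ℕ}

/-- **THE COMPLEMENT OF THE INTERIOR EVENT IS A LARGE-FIELD HISTORY FOR THE PROFILE `c·b₀`**: `histGood(θBal(c·b₀)) ⊆ histGoodInt`, so its
Gibbs mass is bounded by `HistoryTailAt F γ (c·b₀) p₀ m` — crux #3 at a rescaled profile. [cite: Balaban1985UV3, (71) p.273] -/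
theorem tail_histGoodInt (hγ : 0 ≤ γ) (hcθ : ∀ i, θBal F.L γ (c * b₀) p₀ i ≤ θBal F.L γ b₀ p₀ i)
    (hT : HistoryTailAt F γ (c * b₀) p₀ m) :
    ∃ w : ℕ → ℝ, Summable w ∧ ∀ K,
      (gibbsK F ℰp γ K).real (histGoodInt F (θBal F.L γ b₀ p₀) (θBal F.L γ (c * b₀) p₀ (K / m)) K (K / m))ᶜ ≤ w K ∧
      (gibbsK F ℰp γ (K + 1)).real
          (histGoodInt F (θBal F.L γ b₀ p₀) (θBal F.L γ (c * b₀) p₀ (K / m)) (K + 1) (K / m))ᶜ ≤ w K := by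
  obtain ⟨w, hw, hb⟩ := hT
  refine ⟨w, hw, fun K => ⟨?_, ?_⟩⟩
  · haveI := isProbabilityMeasure_gibbsK F ℰp hγ K
    exact (measureReal_mono (Set.compl_subset_compl.mpr
      (histGood_subset_histGoodInt F hcθ (Nat.div_le_self K m) le_rfl))).trans (hb K).1
  · haveI := isProbabilityMeasure_gibbsK F ℰp hγ (K + 1)
    exact (measureReal_mono (Set.compl_subset_compl.mpr
      (histGood_subset_histGoodInt F hcθ ((Nat.div_le_self K m).trans (Nat.le_succ K)) le_rfl))).trans (hb K).2

end Tail

/-! ## §5 One family: K1 ∧ K2 at the unit lattice with the interior events -/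

section OneFamily

variable {F : T3Family} {γ b₀ p₀ c : ℝ} {m : ℕ}
  {A₀ A₁ : (K : ℕ) → GaugeField (F.P (K / m)) 0 (Matrix.specialUnitaryGroup (Fin 2) ℂ) → ℝ}

/-- **`UnitTiltTail` FROM THE INTERIOR DATA**: stability on the window + comparison on the `c`-interior + the tail at profile `c·b₀`
(`0 < γ ≤ 1`, `0 < b₀`, `c ≤ 1`). [cite: King1986, Thm 3.4 (3.9)-(3.13) p.656] -/
theorem unitTiltTail_of_interior (hγ : 0 < γ) (hγ1 : γ ≤ 1) (hb : 0 < b₀) (hc1 : c ≤ 1)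
    (hst : BgStabilityAt F γ b₀ p₀ m A₀ A₁) (hfl : BgFluctuationIntAt F γ b₀ p₀ m A₀ A₁ c)
    (hT : HistoryTailAt F γ (c * b₀) p₀ m) :
    ∃ r w w' : ℕ → ℝ, Summable r ∧ Summable w ∧ Summable w' ∧ UnitTiltTail F ℰp γ r w w' := by
  have hcθ : ∀ i, θBal F.L γ (c * b₀) p₀ i ≤ θBal F.L γ b₀ p₀ i := fun i => θBal_mul_le F.hL.2.le hγ hγ1 hb hc1 p₀ i
  obtain ⟨r, hr, hr0, ht⟩ := unitTilt_interior_of_bg hγ.le hcθ hst hfl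
  obtain ⟨w, hw, hb'⟩ := tail_histGoodInt hγ.le hcθ hT
  -- the step `K = 0` is excised by an EMPTY run-`(K+1)` event: the tilt is trivial (`IsTilt.zero_right`), its mass `1` is paid once
  refine ⟨r, w, fun K => w K + (if K = 0 then 1 else 0), hr, hw, hw.add (hasSum_ite_eq 0 (1 : ℝ)).summable,
    fun K => histGoodInt F (θBal F.L γ b₀ p₀) (θBal F.L γ (c * b₀) p₀ (K / m)) K (K / m),
    fun K => if K = 0 then ∅ else histGoodInt F (θBal F.L γ b₀ p₀) (θBal F.L γ (c * b₀) p₀ (K / m)) (K + 1) (K / m),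
    fun K => measurableSet_histGoodInt F _ _ K _, fun K => ?_, fun K => ?_, fun K => ⟨(hb' K).1, ?_⟩⟩
  · by_cases hK : K = 0
    · simp only [hK, ↓reduceIte, MeasurableSet.empty]
    · simp only [hK, ↓reduceIte]
      exact measurableSet_histGoodInt F _ _ (K + 1) _
  · by_cases hK : K = 0
    · simp only [hK, ↓reduceIte, Measure.restrict_empty, Measure.map_zero]
      exact IsTilt.zero_right _ (hr0 0)
    · simp only [hK, ↓reduceIte]
      exact ht K (Nat.pos_of_ne_zero hK)
  · by_cases hK : K = 0
    · haveI := isProbabilityMeasure_gibbsK F ℰp hγ.le (K + 1)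
      simp only [hK, ↓reduceIte, Set.compl_empty, probReal_univ]
      exact le_add_of_nonneg_left ((measureReal_nonneg).trans (hb' 0).1)
    · simp only [hK, ↓reduceIte, add_zero]
      exact (hb' K).2

end OneFamily

/-! ## §6 The re-glued deciding theorem -/

/-- **`closesInt` — THE ROUTE'S DECIDING THEOREM WITH 19935 REPLACED BY THE INTERIOR TEXT 19935ᴵ** (kernel-checked).  Order of choices:
`c, (b₁,p₁)` from 19935ᴵ at `L = F.L`; #3's profile `(b₀', p₀) ⪰ (b₁, p₁)` and its tail at every `m`; the COMPARISON PROFILE `b₀ := b₀'/c ⪰ b₁`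
(so that the interior threshold `θBal(c·b₀) = θBal(b₀')` is #3's); `ε₀, m, γ⋆` as in `closes` rev 11, `γ⋆ ≤ 1`; refine below `γ⋆`; §5 for the
refined family; `continuumYM3Torus_of_refine_unitTiltTail`. [cite: King1986, Thm 3.4 (3.9)-(3.13) p.656 and (3.12) p.657] -/
theorem closesInt (h200 : Theses.UnitScaleTilt.MinimiserStabilityRegPr) (h201 : FluctuationComparisonRegPrIntL)
    (hK2 : Theses.UnitScaleTilt.HistoryTailL) : T3YM3TorusStatement.YM3TorusSU2 := by
  refine ⟨1, one_pos, fun F γ hγ _ => ?_⟩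
  obtain ⟨c, b₁, p₁, hc0, hc1, hB⟩ := h201 F.L
  obtain ⟨b₀', p₀, hb₁, hp₁, hb₀', hp₀, hT⟩ := hK2 F.L b₁ p₁
  have hb₀ : 0 < b₀' / c := div_pos hb₀' hc0
  have hb₁' : b₁ ≤ b₀' / c := by
    refine hb₁.trans ?_
    rw [le_div_iff₀ hc0]
    exact mul_le_of_le_one_right hb₀'.le hc1
  have hcb : c * (b₀' / c) = b₀' := by field_simp
  obtain ⟨ε₁, hε₁, hA⟩ := h200 F.L
  obtain ⟨ε₁', hε₁', hB'⟩ := hB (b₀' / c) p₀ hb₁' hp₁ hb₀ hp₀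
  obtain ⟨m₁, hm₁⟩ := hA (min ε₁ ε₁') (lt_min hε₁ hε₁') (min_le_left _ _)
  obtain ⟨m₂, hm₂⟩ := hB' (min ε₁ ε₁') (lt_min hε₁ hε₁') (min_le_right _ _)
  obtain ⟨γ₂, hγ₂, hT'⟩ := hT (max (max m₁ m₂) 1) (lt_of_lt_of_le Nat.one_pos (le_max_right _ _))
  obtain ⟨γ₃, hγ₃, hA'⟩ := hm₁ (max (max m₁ m₂) 1) ((le_max_left _ _).trans (le_max_left _ _)) (b₀' / c) p₀ hb₀ hp₀
  obtain ⟨γ₄, hγ₄, hB''⟩ := hm₂ (max (max m₁ m₂) 1) ((le_max_right _ _).trans (le_max_left _ _))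
  have hL : (1 : ℝ) < F.L := by exact_mod_cast F.hL.2
  have hL0 : (0 : ℝ) < F.L := zero_lt_one.trans hL
  have hγs : 0 < min (min γ₂ (min γ₃ γ₄)) 1 := lt_min (lt_min hγ₂ (lt_min hγ₃ hγ₄)) one_pos
  obtain ⟨n, hn⟩ := ((tendsto_pow_atTop_nhds_zero_of_lt_one (inv_nonneg.mpr hL0.le)
    (inv_lt_one_of_one_lt₀ hL)).eventually (ge_mem_nhds (div_pos hγs hγ))).exists
  have hpos : 0 < γ * ((F.L : ℝ)⁻¹) ^ n := mul_pos hγ (pow_pos (inv_pos.mpr hL0) n)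
  have hle : γ * ((F.L : ℝ)⁻¹) ^ n ≤ min (min γ₂ (min γ₃ γ₄)) 1 := by
    have e := mul_le_mul_of_nonneg_left hn hγ.le
    rwa [mul_div_cancel₀ _ hγ.ne'] at e
  have hle₂ : γ * ((F.L : ℝ)⁻¹) ^ n ≤ γ₂ := hle.trans ((min_le_left _ _).trans (min_le_left _ _))
  have hle₃ : γ * ((F.L : ℝ)⁻¹) ^ n ≤ γ₃ :=
    hle.trans ((min_le_left _ _).trans ((min_le_right _ _).trans (min_le_left _ _)))
  have hle₄ : γ * ((F.L : ℝ)⁻¹) ^ n ≤ γ₄ :=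
    hle.trans ((min_le_left _ _).trans ((min_le_right _ _).trans (min_le_right _ _)))
  have hle1 : γ * ((F.L : ℝ)⁻¹) ^ n ≤ 1 := hle.trans (min_le_right _ _)
  have hTn : HistoryTailAt (F.refine n) (γ * ((F.L : ℝ)⁻¹) ^ n) (c * (b₀' / c)) p₀ (max (max m₁ m₂) 1) := by
    rw [hcb]
    exact hT' (F.refine n) _ rfl hpos hle₂
  have hst : BgStabilityAt (F.refine n) (γ * ((F.L : ℝ)⁻¹) ^ n) (b₀' / c) p₀ (max (max m₁ m₂) 1)
      (bgRegPr (F.refine n) (γ * ((F.L : ℝ)⁻¹) ^ n) (max (max m₁ m₂) 1) (min ε₁ ε₁'))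
      (bgRegPr' (F.refine n) (γ * ((F.L : ℝ)⁻¹) ^ n) (max (max m₁ m₂) 1) (min ε₁ ε₁')) :=
    hA' (F.refine n) _ rfl hpos hle₃
  have hfl : BgFluctuationIntAt (F.refine n) (γ * ((F.L : ℝ)⁻¹) ^ n) (b₀' / c) p₀ (max (max m₁ m₂) 1)
      (bgRegPr (F.refine n) (γ * ((F.L : ℝ)⁻¹) ^ n) (max (max m₁ m₂) 1) (min ε₁ ε₁'))
      (bgRegPr' (F.refine n) (γ * ((F.L : ℝ)⁻¹) ^ n) (max (max m₁ m₂) 1) (min ε₁ ε₁')) c :=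
    hB'' (F.refine n) _ rfl hpos hle₄
  obtain ⟨r, w, w', hr, hw, hw', h⟩ := unitTiltTail_of_interior hpos hle1 hb₀ hc1 hst hfl hTn
  exact continuumYM3Torus_of_refine_unitTiltTail F ℰp measurableE_ℰp n hγ.le hr hw hw' h

/-! ## §7 Why the interior text is easier: the inner socket alone feeds it, and the interior is doubly χ-good -/

section Socket

variable {F : T3Family} {γ b₀ p₀ ε₀ c : ℝ} {m : ℕ}

/-- **THE INTERIOR COMPARISON FROM THE `S`-RESTRICTED SOCKET — NO EDGE CLAUSE.**  For one family: ★r1's restricted socket (`TwoSidedRepOn S`: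
[Balaban1985UV3] (41)∧(47) pinned, asserted on data satisfying `S`; `PintCauchyOn S`: King's cut-off-Cauchy property of the interaction sums on
doubly-`S` data), ANY predicate `S` that the `c`-interior implies for both runs almost everywhere, and positivity of both densities on the
interior (steps `K ≥ 1`) give `FluctuationComparisonRegPrIntAt F γ b₀ p₀ m c ε₀` (`…PrintChiLine.stubBodyOn_of_repOn_of_cauchyOn` by name).
With `S := ChiGood(μ_L)` and `m ≥ 2` the hypothesis `hS` is (E1) below (`⌊K/m⌋ < K` for `K ≥ 1`). [cite: King1986, Prop. 3.8-3.9 pp.664-665] -/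
theorem bgFluctuationIntAt_of_socketOn (hm : 0 < m)
    (S : (K n : ℕ) → n ≤ K → GaugeField (F.P n) 0 (Matrix.specialUnitaryGroup (Fin 2) ℂ) → Prop)
    {Pint : (K n : ℕ) → GaugeField (F.P n) 0 (Matrix.specialUnitaryGroup (Fin 2) ℂ) → ℝ} {E Rm : ℕ → ℕ → ℝ}
    (hrep : Theorems.PrintChi.TwoSidedRepOn F γ b₀ p₀ S ε₀ Pint E Rm) (hcauchy : Theorems.PrintChi.PintCauchyOn F γ b₀ p₀ S m Pint)
    (hcθ : ∀ i, θBal F.L γ (c * b₀) p₀ i ≤ θBal F.L γ b₀ p₀ i)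
    (hS : ∀ K, 0 < K → ∀ᵐ V ∂fieldMeasure (F.P (K / m)) 0 (Matrix.specialUnitaryGroup (Fin 2) ℂ),
      PlaqSmall (θBal F.L γ (c * b₀) p₀ (K / m)) V →
        S K (K / m) (Nat.div_le_self K m) V ∧ S (K + 1) (K / m) ((Nat.div_le_self K m).trans (Nat.le_succ K)) V)
    (hposI : ∀ K, 0 < K → ∀ᵐ V ∂fieldMeasure (F.P (K / m)) 0 (Matrix.specialUnitaryGroup (Fin 2) ℂ),
      PlaqSmall (θBal F.L γ (c * b₀) p₀ (K / m)) V →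
        0 < heightDensity F γ (Nat.div_le_self K m) (histGood F ℰp (θBal F.L γ b₀ p₀) K (K / m)) V ∧
        0 < heightDensity F γ ((Nat.div_le_self K m).trans (Nat.le_succ K)) (histGood F ℰp (θBal F.L γ b₀ p₀) (K + 1) (K / m)) V) :
    FluctuationComparisonRegPrIntAt F γ b₀ p₀ m c ε₀ := by
  obtain ⟨r, κ, hr, hr0, hae⟩ :=
    Theorems.PrintChi.stubBodyOn_of_repOn_of_cauchyOn F γ b₀ p₀ ε₀ hm S Pint E Rm hrep hcauchy
  refine ⟨r, κ, hr, hr0, fun K hK => ?_⟩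
  filter_upwards [hae K, hS K hK, hposI K hK] with V hV hSV hpV hs
  obtain ⟨h0, h1⟩ := hpV hs
  obtain ⟨hs0, hs1⟩ := hSV hs
  exact ⟨h0, h1, hV (fun p => (hs p).trans_le (hcθ _)) hs0 hs1 h0 h1⟩

/-- **(E1) THE DEEP INTERIOR IS χ-GOOD, FROM [Balaban1985Variational] THM 1 (8) IN THE TREE'S GLOBAL READING `Thm1GlobalMinAt`** — at BLOCK-SIZE
LEVEL (the coupling threshold depends on `L, b₀, p₀, ε₀, a₁, B₃, c` only, so it hoists above `∀ F`).  If `B₃·c ≤ 1` then below the threshold every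
datum `V` with `PlaqSmall (θBal(c·b₀) n) V` (`n < K`) is χ-good for run `K` with print's margin `μ_L = 1 − 2/(L√L)`: Thm 1 at radius
`ε₁ := θBal(c·b₀)(n) = c·θBal(b₀)(n)` (`≤ a₁`, `B₃ε₁ ≤ ε₀ ≤ a₀` for small `γ`) puts the minimiser in (8) — finest plaquettes `< B₃ε₁η^{2(K−n)} ≤
θBal(b₀)(n)η^{2(K−n)}`, print's `χ_k` — and `…PrintChiTransfer.chiGood_of_printChi_sharp` ([Balaban1985Averaging] Prop. 2 (53)) does the rest.  ANY
finite `B₃(L)` serves (`c := B₃⁻¹ ∧ 1`): no «margin < 1» condition, no block-size restriction. [cite: Balaban1985Variational, Thm 1 (8) p.279] -/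
theorem interior_chiGood_of_thm1GlobalMinAt {L : ℕ} (hL : 1 ≤ L) {a₀ a₁ B₃ : ℝ} (hT : Thm1GlobalMinAt L a₀ a₁ B₃) (ha₁ : 0 < a₁)
    (hB₃ : 0 < B₃) (hb : 0 < b₀) (hp : 0 ≤ p₀) (hε₀ : 0 < ε₀) (hε₀a : ε₀ ≤ a₀) (hc0 : 0 < c) (hcB : B₃ * c ≤ 1) :
    ∃ γ₁ : ℝ, 0 < γ₁ ∧ γ₁ ≤ 1 ∧ ∀ (F : T3Family) (γ : ℝ), F.L = L → 0 < γ → γ ≤ γ₁ → ∀ {n K : ℕ} (hnK : n < K)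
      (V : GaugeField (F.P n) 0 (Matrix.specialUnitaryGroup (Fin 2) ℂ)),
      PlaqSmall (θBal F.L γ (c * b₀) p₀ n) V →
        Theorems.PrintChi.ChiGood F γ b₀ p₀ ε₀ (1 - 2 / ((F.L : ℝ) * Real.sqrt F.L)) hnK.le V := by
  have hL0 : (0 : ℝ) < L := by exact_mod_cast (show 0 < L by omega)
  -- print's two averaging constants, exactly as in `…PrintChiTransfer.exists_coupling_chiGood_of_printChi`
  have hC₀ : (0 : ℝ) < 143 * ((((3 + 4 : ℕ) : ℝ)) ^ 2 / 4) ^ 2 := by positivity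
  have h7L : (0 : ℝ) < (((3 + 4) * L : ℕ) : ℝ) ^ 2 := by
    have : 0 < (3 + 4) * L := by omega
    positivity
  obtain ⟨γ₀, hγ₀, hsmall₀⟩ := exists_forall_θBal_le hL b₀ p₀
    (lt_min (div_pos (by norm_num : (0 : ℝ) < 1 / 3) hC₀) (div_pos ExpMeanLog.deltaSU_pos h7L) :
      (0 : ℝ) < min (1 / 3 / (143 * ((((3 + 4 : ℕ) : ℝ)) ^ 2 / 4) ^ 2)) (ExpMeanLog.deltaSU (Fin 2) / (((3 + 4) * L : ℕ) : ℝ) ^ 2))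
  obtain ⟨γ_b, hγ_b, hsmall⟩ := exists_forall_θBal_le hL (c * b₀) p₀ (lt_min ha₁ (div_pos hε₀ hB₃))
  refine ⟨min (min γ₀ γ_b) 1, lt_min (lt_min hγ₀ hγ_b) one_pos, min_le_right _ _, fun F γ hF hγ hγle n K hnK V hV => ?_⟩
  subst hF
  have hLs : 0 < (F.L : ℝ) * Real.sqrt F.L := by positivity
  have hγa : γ ≤ γ₀ := hγle.trans ((min_le_left _ _).trans (min_le_left _ _))
  have hγb : γ ≤ γ_b := hγle.trans ((min_le_left _ _).trans (min_le_right _ _))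
  have hγ1 : γ ≤ 1 := hγle.trans (min_le_right _ _)
  have hcb : 0 < c * b₀ := mul_pos hc0 hb
  have hε₁ : 0 < θBal F.L γ (c * b₀) p₀ n := θBal_pos hL hγ hγ1 hcb p₀ n
  have hθ := hsmall γ hγ hγb n
  have hε₁a : θBal F.L γ (c * b₀) p₀ n ≤ a₁ := hθ.trans (min_le_left _ _)
  have hlo : B₃ * θBal F.L γ (c * b₀) p₀ n ≤ ε₀ := by
    have h := hθ.trans (min_le_right _ _)
    rwa [le_div_iff₀ hB₃, mul_comm] at h
  obtain ⟨U, hU8, hmin⟩ := hT F rfl n K hnK _ ε₀ hε₁ hε₁a hlo hε₀a V hV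
  have hU6 : U ∈ regFibrePr F n K hnK.le ε₀ V := regFibrePr_mono F hlo V hU8
  have hminEq := minActionRegPr_eq_of_isMinOn F hU6 hmin
  -- print's `χ_k` for the minimiser: finest plaquettes `< B₃·θBal(c b₀)(n)·η² ≤ θBal(b₀)(n)·η²`
  have hχU : PlaqSmall (θBal F.L γ b₀ p₀ n * ((F.L : ℝ)⁻¹) ^ (2 * (K - n))) U := by
    have h8 : PlaqSmall (regThreshold F n K (B₃ * θBal F.L γ (c * b₀) p₀ n)) U := ((mem_regFibrePr_iff F).mp hU8).2.1
    refine fun p => (h8 p).trans_le ?_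
    show B₃ * θBal F.L γ (c * b₀) p₀ n * ((F.L : ℝ)⁻¹) ^ (2 * (K - n)) ≤ θBal F.L γ b₀ p₀ n * ((F.L : ℝ)⁻¹) ^ (2 * (K - n))
    refine mul_le_mul_of_nonneg_right ?_ (pow_nonneg (inv_nonneg.mpr (Nat.cast_nonneg _)) _)
    rw [θBal_mul, ← mul_assoc]
    exact mul_le_of_le_one_left (θBal_pos hL hγ hγ1 hb p₀ n).le hcB
  have hθc := hsmall₀ γ hγ hγa n
  refine Theorems.PrintChi.chiGood_of_printChi_sharp hγ hγ1 hb hp hnK.le hU6 hminEq hχU ?_ ?_ (le_of_eq ?_)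
  · have h1 : θBal F.L γ b₀ p₀ n ≤ 1 / 3 / (143 * ((((3 + 4 : ℕ) : ℝ)) ^ 2 / 4) ^ 2) := hθc.trans (min_le_left _ _)
    rwa [le_div_iff₀ hC₀, mul_comm] at h1
  · have h2 : θBal F.L γ b₀ p₀ n ≤ ExpMeanLog.deltaSU (Fin 2) / (((3 + 4) * F.L : ℕ) : ℝ) ^ 2 := hθc.trans (min_le_right _ _)
    rw [mul_div_assoc]
    linarith
  · field_simp
    ring

end Socket

/-! ## §8 19935ᴵ at block-size level from the inner socket body and window positivity -/

section BlockSize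

/-- **19935ᴵ ⇐ THE INNER BODY FOR EVERY ODD BLOCK SIZE + WINDOW POSITIVITY + THM 1.**  Hypotheses, all with the route's quantifier prefix:
`hThm1` = [Balaban1985Variational] Thm 1 + Prop 7 in the tree's global reading at every odd `L > 1` (a DISPLAYED schema of the line of record:
`AlphaInputsT3ACMinimiserPinTriv`, `HasRegMinimisersPrAt`); `hInner` = for every odd `L > 1` ★r1's sanctioned INNER stub body (i)* — the registered
4′ body asserted only at data χ-good for BOTH runs with print's margin `μ_L` (verbatim the `hInner` of `…PrintChiSocket.stub_logComparisonSmallBlocks_of_chi_edge`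
WITHOUT the restriction `L < 7`; for `L ≥ 7` it is implied outright by the full-window body of the large-`L` chain (3⁗ + socket));
`hPos` = positivity of both restricted densities on the window, verbatim the conclusion shape of the LANDED
`OneStepSubmersion.posOnSmall_of_oneStepSmallLift` (p446430 ∘ p490827; discharged by name in `regPrIntL_of_innerChi'`).  Conclusion: the proposed
item text `FluctuationComparisonRegPrIntL` — with `c := (max B₃ 1)⁻¹`, `m₀ ≥ 2`.  NO edge-oscillation clause (ii)* and NO `K = 0` corner anywhere.
[cite: Balaban1985UV3, (41) p.266 and (47) p.267] -/
theorem regPrIntL_of_innerChi (hThm1 : ∀ L : ℕ, Odd L → 1 < L → Thm1GlobalMin L)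
    (hInner : ∀ L : ℕ, Odd L → 1 < L → ∃ (b₁ p₁ : ℝ), ∀ (b₀ p₀ : ℝ), b₁ ≤ b₀ → p₁ ≤ p₀ → 0 < b₀ → 2 < p₀ →
      ∃ ε₁ : ℝ, 0 < ε₁ ∧ ∀ (ε₀ : ℝ), 0 < ε₀ → ε₀ ≤ ε₁ → ∃ m₀ : ℕ, ∀ (m : ℕ), m₀ ≤ m →
        ∃ γ₁ : ℝ, 0 < γ₁ ∧ ∀ (F : T3Family) (γ : ℝ), F.L = L → 0 < γ → γ ≤ γ₁ →
          ∃ (r κ : ℕ → ℝ), Summable r ∧ (∀ K, 0 ≤ r K) ∧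
            ∀ K, ∀ᵐ V ∂fieldMeasure (F.P (K / m)) 0 (Matrix.specialUnitaryGroup (Fin 2) ℂ),
              PlaqSmall (θBal F.L γ b₀ p₀ (K / m)) V →
                Theorems.PrintChi.ChiGood F γ b₀ p₀ ε₀ (1 - 2 / ((F.L : ℝ) * Real.sqrt F.L)) (Nat.div_le_self K m) V →
                Theorems.PrintChi.ChiGood F γ b₀ p₀ ε₀ (1 - 2 / ((F.L : ℝ) * Real.sqrt F.L))
                    ((Nat.div_le_self K m).trans (Nat.le_succ K)) V →
                0 < heightDensity F γ (Nat.div_le_self K m) (histGood F ℰp (θBal F.L γ b₀ p₀) K (K / m)) V →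
                0 < heightDensity F γ ((Nat.div_le_self K m).trans (Nat.le_succ K))
                      (histGood F ℰp (θBal F.L γ b₀ p₀) (K + 1) (K / m)) V →
                  |(Real.log (heightDensity F γ ((Nat.div_le_self K m).trans (Nat.le_succ K))
                        (histGood F ℰp (θBal F.L γ b₀ p₀) (K + 1) (K / m)) V) + bgRegPr' F γ m ε₀ K V) -
                    (Real.log (heightDensity F γ (Nat.div_le_self K m) (histGood F ℰp (θBal F.L γ b₀ p₀) K (K / m)) V) +
                      bgRegPr F γ m ε₀ K V) - κ K| ≤ r K)
    (hPos : ∀ (L m : ℕ), 0 < m → ∀ (b₀ p₀ : ℝ), 0 < b₀ → 2 < p₀ → ∃ γ₁ : ℝ, 0 < γ₁ ∧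
      ∀ (F : T3Family) (γ : ℝ), F.L = L → 0 < γ → γ ≤ γ₁ →
        ∀ K, ∀ᵐ V ∂fieldMeasure (F.P (K / m)) 0 (Matrix.specialUnitaryGroup (Fin 2) ℂ),
          PlaqSmall (θBal F.L γ b₀ p₀ (K / m)) V →
            0 < heightDensity F γ (Nat.div_le_self K m) (histGood F ℰp (θBal F.L γ b₀ p₀) K (K / m)) V ∧
            0 < heightDensity F γ ((Nat.div_le_self K m).trans (Nat.le_succ K))
                  (histGood F ℰp (θBal F.L γ b₀ p₀) (K + 1) (K / m)) V) :
    FluctuationComparisonRegPrIntL := by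
  intro L
  by_cases hL : Odd L ∧ 1 < L
  swap
  · -- no family has this block size
    refine ⟨1, 0, 0, one_pos, le_rfl, fun b₀ p₀ _ _ _ _ => ⟨1, one_pos, fun ε₀ _ _ => ⟨0, fun m _ => ⟨1, one_pos, ?_⟩⟩⟩⟩
    intro F γ hF
    exact absurd (hF ▸ F.hL : Odd L ∧ 1 < L) hL
  obtain ⟨a₀, a₁, B₃, ha₀, ha₁, hB₃, -, hT⟩ := hThm1 L hL.1 hL.2
  obtain ⟨b₁, p₁, hI⟩ := hInner L hL.1 hL.2
  have hM : 0 < max B₃ 1 := lt_max_of_lt_right one_pos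
  have hc0 : 0 < (max B₃ 1)⁻¹ := inv_pos.mpr hM
  have hc1 : (max B₃ 1)⁻¹ ≤ 1 := inv_le_one_of_one_le₀ (le_max_right _ _)
  have hcB : B₃ * (max B₃ 1)⁻¹ ≤ 1 := by
    rw [← div_eq_mul_inv, div_le_one hM]
    exact le_max_left _ _
  refine ⟨(max B₃ 1)⁻¹, b₁, p₁, hc0, hc1, fun b₀ p₀ hb₁ hp₁ hb hp => ?_⟩
  obtain ⟨ε₁, hε₁, hI1⟩ := hI b₀ p₀ hb₁ hp₁ hb hp
  refine ⟨min ε₁ a₀, lt_min hε₁ ha₀, fun ε₀ hε₀ hε₀le => ?_⟩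
  obtain ⟨m₀, hI2⟩ := hI1 ε₀ hε₀ (hε₀le.trans (min_le_left _ _))
  refine ⟨max m₀ 2, fun m hm => ?_⟩
  have hm2 : 2 ≤ m := (le_max_right _ _).trans hm
  obtain ⟨γ₁, hγ₁, hI3⟩ := hI2 m ((le_max_left _ _).trans hm)
  obtain ⟨γE, hγE, hγE1, hE1⟩ := interior_chiGood_of_thm1GlobalMinAt hL.2.le hT ha₁ hB₃ hb (zero_le_two.trans hp.le) hε₀
    (hε₀le.trans (min_le_right _ _)) hc0 hcB
  obtain ⟨γP, hγP, hP⟩ := hPos L m (by omega) b₀ p₀ hb hp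
  refine ⟨min (min γ₁ γE) γP, lt_min (lt_min hγ₁ hγE) hγP, fun F γ hF hγ hγle => ?_⟩
  have hγ₁' : γ ≤ γ₁ := hγle.trans ((min_le_left _ _).trans (min_le_left _ _))
  have hγE' : γ ≤ γE := hγle.trans ((min_le_left _ _).trans (min_le_right _ _))
  have hγP' : γ ≤ γP := hγle.trans (min_le_right _ _)
  obtain ⟨r, κ, hr, hr0, hbody⟩ := hI3 F γ hF hγ hγ₁'
  have hγ1 : γ ≤ 1 := hγE'.trans hγE1
  have hcθ : ∀ i, θBal F.L γ ((max B₃ 1)⁻¹ * b₀) p₀ i ≤ θBal F.L γ b₀ p₀ i :=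
    fun i => θBal_mul_le F.hL.2.le hγ hγ1 hb hc1 p₀ i
  refine ⟨r, κ, hr, hr0, fun K hK => ?_⟩
  have hlt : K / m < K := Nat.div_lt_self hK (by omega)
  have hlt' : K / m < K + 1 := hlt.trans (Nat.lt_succ_self K)
  filter_upwards [hbody K, hP F γ hF hγ hγP' K] with V hb' hpV hs
  have hsw : PlaqSmall (θBal F.L γ b₀ p₀ (K / m)) V := fun p => (hs p).trans_le (hcθ _)
  obtain ⟨h0, h1⟩ := hpV hsw
  exact ⟨h0, h1, hb' hsw (hE1 F γ hF hγ hγE' hlt V hs) (hE1 F γ hF hγ hγE' hlt' V hs) h0 h1⟩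

/-- **THE SAME WITH WINDOW POSITIVITY DISCHARGED BY NAME** (`OneStepSubmersion.posOnSmall_of_oneStepSmallLift` ∘ the landed
`ApproxLift.AnsatzT.stub_oneStepSmallLift`): 19935ᴵ ⇐ Thm 1 (displayed schema) + the inner body (i)* at every odd block size.
[cite: Balaban1985UV3, (41) p.266 and (47) p.267] -/
theorem regPrIntL_of_innerChi' (hThm1 : ∀ L : ℕ, Odd L → 1 < L → Thm1GlobalMin L)
    (hInner : ∀ L : ℕ, Odd L → 1 < L → ∃ (b₁ p₁ : ℝ), ∀ (b₀ p₀ : ℝ), b₁ ≤ b₀ → p₁ ≤ p₀ → 0 < b₀ → 2 < p₀ →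
      ∃ ε₁ : ℝ, 0 < ε₁ ∧ ∀ (ε₀ : ℝ), 0 < ε₀ → ε₀ ≤ ε₁ → ∃ m₀ : ℕ, ∀ (m : ℕ), m₀ ≤ m →
        ∃ γ₁ : ℝ, 0 < γ₁ ∧ ∀ (F : T3Family) (γ : ℝ), F.L = L → 0 < γ → γ ≤ γ₁ →
          ∃ (r κ : ℕ → ℝ), Summable r ∧ (∀ K, 0 ≤ r K) ∧
            ∀ K, ∀ᵐ V ∂fieldMeasure (F.P (K / m)) 0 (Matrix.specialUnitaryGroup (Fin 2) ℂ),
              PlaqSmall (θBal F.L γ b₀ p₀ (K / m)) V →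
                Theorems.PrintChi.ChiGood F γ b₀ p₀ ε₀ (1 - 2 / ((F.L : ℝ) * Real.sqrt F.L)) (Nat.div_le_self K m) V →
                Theorems.PrintChi.ChiGood F γ b₀ p₀ ε₀ (1 - 2 / ((F.L : ℝ) * Real.sqrt F.L))
                    ((Nat.div_le_self K m).trans (Nat.le_succ K)) V →
                0 < heightDensity F γ (Nat.div_le_self K m) (histGood F ℰp (θBal F.L γ b₀ p₀) K (K / m)) V →
                0 < heightDensity F γ ((Nat.div_le_self K m).trans (Nat.le_succ K))
                      (histGood F ℰp (θBal F.L γ b₀ p₀) (K + 1) (K / m)) V →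
                  |(Real.log (heightDensity F γ ((Nat.div_le_self K m).trans (Nat.le_succ K))
                        (histGood F ℰp (θBal F.L γ b₀ p₀) (K + 1) (K / m)) V) + bgRegPr' F γ m ε₀ K V) -
                    (Real.log (heightDensity F γ (Nat.div_le_self K m) (histGood F ℰp (θBal F.L γ b₀ p₀) K (K / m)) V) +
                      bgRegPr F γ m ε₀ K V) - κ K| ≤ r K) :
    FluctuationComparisonRegPrIntL :=
  regPrIntL_of_innerChi hThm1 hInner
    (Theorems.OneStepSubmersion.posOnSmall_of_oneStepSmallLift Theorems.ApproxLift.AnsatzT.stub_oneStepSmallLift)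

end BlockSize


end Summit.QuantumFields.YangMills.Cruxes.FluctuationComparisonRegPr.Ideate2Excision

end
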